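import Summits.QuantumAdvantage.QuantumAdvantage.Theorems.CubicForrelationNearExactIsExactTenBalancedA
import Summits.QuantumAdvantage.QuantumAdvantage.Theorems.CubicForrelationNearExactIsExactAffineForm
import Summits.QuantumAdvantage.QuantumAdvantage.Theorems.CubicForrelationSignedCubicForrelationNotPrBPPStubKernelNormalFormDegree

/-!
# Crux `CubicForrelation.NearExactIsExact` (stmt-QuantumAdvantage-14043), line `direct-sum-amplification`,
  stub `stub_cubicEvenOnFourFlat` — a 9-variable cubic has even parity on every 4-dimensional cube

Soundness of the `f`-side certificates of the `n = 10` census: for `F : 𝔽₂⁹ → 𝔽₂` of algebraic degree `≤ 3`,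
a base point `b` and four (not necessarily independent) directions `u₀, …, u₃`, the number of
`ε ∈ 𝔽₂⁴` with `F(b ⊕ Σ_{εᵢ = 1} uᵢ) = 1` is EVEN (equivalently: the fourth derivative
`D_{u₃} D_{u₂} D_{u₁} D_{u₀} F` of a cubic vanishes).

Proof.  Pull `F` back along the affine map `ε ↦ b ⊕ Σ_{εᵢ = 1} uᵢ : 𝔽₂⁴ → 𝔽₂⁹`, whose coordinates
`ε ↦ b_j ⊕ (ε₀ ∧ u₀ⱼ) ⊕ ⋯ ⊕ (ε₃ ∧ u₃ⱼ)` are affine; the pullback `h : 𝔽₂⁴ → 𝔽₂` is again cubic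
(`knf_isDegLeFun_comp`, substitution of degree-`≤ 1` polynomials).  A cubic on FOUR bits has even weight:
by Ax's / McEliece's theorem on the full cube (the landed `stub_axParity`, `d = 3`, `|K| = 4`,
`⌈4/3⌉ = 2`) the bias `Σ_ε (−1)^{h(ε)} = 16 − 2·wt(h)` lies in `4ℤ`, so `wt(h)` is even
(`cf_even_card_of_cubic_four`).  (For a single monomial of degree `≤ 3` in `4` variables one variable is
free, which is the derivative argument of the line's blueprint in its dual form.)

References: C. Carlet, *Boolean Functions for Cryptography and Coding Theory*, CUP 2020, §2.2 (derivatives,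
`deg D_t f ≤ deg f − 1`) and §4.1 (McEliece's theorem); F. J. MacWilliams, N. J. A. Sloane, *The Theory of
Error-Correcting Codes* (1977), Ch. 13 §3, Ch. 15 §3.  Everything is proved from the tree (`stub_axParity`,
`knf_isDegLeFun_comp`, `fc_sum_signOf_eq_card`) and Mathlib; axioms are the standard three.
-/

set_option linter.dupNamespace false -- D-0017: single-problem summit ⇒ `QuantumAdvantage.QuantumAdvantage` by design

noncomputable section

namespace Summit.QuantumAdvantage.QuantumAdvantage.Theorems.CubicForrelation.NearExactIsExact

open Finset
open Literature.Computability.QuantumComplexity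
open Literature.Computability.QuantumComplexity.BuzetChailloux (bxor zeroVec)
open Summit.QuantumAdvantage.QuantumAdvantage.Theorems.SignedCubicForrelationNotPrBPP
  (knf_isDegLeFun_comp knf_isDegLeFun_and_const)

/-! ### A cubic on four bits has even weight -/

/-- **Weights of `RM(3,4)` are even** (Ax 1964 / McEliece 1972 at `q = 2`, `d = 3`, `k = 4`): a Boolean function
of algebraic degree `≤ 3` on `4` bits takes the value `true` an even number of times.  From the landed
`stub_axParity` on the full cube `K = univ`: `Σ_ε (−1)^{h(ε)} = 2⁴ − 2·wt(h) ∈ 2^{⌈4/3⌉} ℤ = 4ℤ`.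
[cite: Carlet2020, §4.1] -/
theorem cf_even_card_of_cubic_four {h : (Fin 4 → Bool) → Bool} (hh : IsDegLeFun 3 h) :
    Even ((univ.filter fun ε : Fin 4 → Bool => h ε = true).card) := by
  obtain ⟨z, hz⟩ := stub_axParity 4 3 h univ (by norm_num) hh
  rw [filter_true_of_mem (fun u _ i _ => mem_univ i), card_fin, fc_sum_signOf_eq_card] at hz
  have h4 : (2 : ℝ) ^ ((4 + 3 - 1) / 3) = 4 := by norm_num
  rw [h4] at hz
  have hc : (((univ.filter fun ε : Fin 4 → Bool => h ε = true).card : ℤ) : ℝ) = ((2 * (4 - z) : ℤ) : ℝ) := by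
    push_cast
    linear_combination (-(1 : ℝ) / 2) * hz
  have he : Even (((univ.filter fun ε : Fin 4 → Bool => h ε = true).card : ℤ)) :=
    ⟨4 - z, by rw [Int.cast_injective hc]; ring⟩
  exact (Int.even_coe_nat _).mp he

/-! ### The pullback of a cubic along a 4-flat is cubic -/

/-- The pullback `ε ↦ F(b ⊕ Σ_{εᵢ = 1} uᵢ)` of a cubic `F : 𝔽₂⁹ → 𝔽₂` along the affine parametrisation of a
4-flat is a cubic on `𝔽₂⁴`: each coordinate `ε ↦ b_j ⊕ (ε₀ ∧ u₀ⱼ) ⊕ (ε₁ ∧ u₁ⱼ) ⊕ (ε₂ ∧ u₂ⱼ) ⊕ (ε₃ ∧ u₃ⱼ)` is affine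
(`isDegLeFun_const`, `knf_isDegLeFun_and_const`, `fc_deg_bxor`), so `knf_isDegLeFun_comp` applies.
[cite: Carlet2020, §2.2.1 Def. 6] -/
theorem cf_deg_pullback (F : (Fin (4 + 4 + 1) → Bool) → Bool) (b : Fin (4 + 4 + 1) → Bool)
    (u : Fin 4 → Fin (4 + 4 + 1) → Bool) (hF : IsDegLeFun 3 F) :
    IsDegLeFun 3 (fun ε : Fin 4 → Bool =>
      F (fun j => b j ^^ ((ε 0 && u 0 j) ^^ (ε 1 && u 1 j) ^^ (ε 2 && u 2 j) ^^ (ε 3 && u 3 j)))) :=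
  knf_isDegLeFun_comp hF
    (fun (ε : Fin 4 → Bool) (j : Fin (4 + 4 + 1)) =>
      b j ^^ ((ε 0 && u 0 j) ^^ (ε 1 && u 1 j) ^^ (ε 2 && u 2 j) ^^ (ε 3 && u 3 j)))
    fun j => fc_deg_bxor (isDegLeFun_const 1 (b j))
      (fc_deg_bxor (fc_deg_bxor (fc_deg_bxor (knf_isDegLeFun_and_const 0 (u 0 j))
        (knf_isDegLeFun_and_const 1 (u 1 j))) (knf_isDegLeFun_and_const 2 (u 2 j)))
        (knf_isDegLeFun_and_const 3 (u 3 j)))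

/-! ### The stub -/

/-- **stub_cubicEvenOnFourFlat** (F1; cubics are even on 4-flats). For `F : 𝔽₂⁹ → 𝔽₂` of algebraic degree `≤ 3`,
a base point `b` and directions `u₀, …, u₃` (no independence needed), the number of `ε ∈ 𝔽₂⁴` with
`F(b ⊕ Σ_{εᵢ = 1} uᵢ) = 1` is even — the `𝔽₂`-sum of a cubic over the `16` points of a 4-dimensional cube
vanishes (fourth derivatives of cubics are zero).  Proof: the pullback to `𝔽₂⁴` is cubic (`cf_deg_pullback`)
and a cubic on four bits has even weight (`cf_even_card_of_cubic_four`, Ax/McEliece via `stub_axParity`).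
[cite: Carlet2020, §4.1] -/
theorem stub_cubicEvenOnFourFlat :
    ∀ (F : (Fin (4 + 4 + 1) → Bool) → Bool) (b : Fin (4 + 4 + 1) → Bool) (u : Fin 4 → Fin (4 + 4 + 1) → Bool),
      IsDegLeFun 3 F →
      Even ((univ.filter fun ε : Fin 4 → Bool =>
        F (fun j => b j ^^ ((ε 0 && u 0 j) ^^ (ε 1 && u 1 j) ^^ (ε 2 && u 2 j) ^^ (ε 3 && u 3 j))) = true).card) := by
  intro F b u hF
  exact cf_even_card_of_cubic_four (cf_deg_pullback F b u hF)

end Summit.QuantumAdvantage.QuantumAdvantage.Theorems.CubicForrelation.NearExactIsExact
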